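import Literature.Probability.RandomPlanarGeometry.CrossingCondition
import Literature.Probability.RandomPlanarGeometry.CurveTortuosity
import HarnessLib

/-!
# Glue: Kemppainen–Smirnov annulus crossings are Aizenman–Burchard shell traversals

Topic `Probability/RandomPlanarGeometry`. Two notions of "the curve crosses the annulus
`A(z₀, r, R)`" live in this directory: `Curve.MakesCrossingIn`/`Curve.MakesCrossing`
(`CrossingCondition.lean`; Kemppainen–Smirnov, Ann. Probab. 45 (2017), Def. 1.1: one crossing,
planar, with the interior of the crossing segment inside the annulus) and
`Curve.HasTraversals γ k x r R` (`CurveTortuosity.lean`; Aizenman–Burchard, Duke Math. J. 99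
(1999), §1.b (1.3): `k` separate traversals, any pseudo-metric space, endpoint condition only).
This file records that they agree where they overlap: a KS crossing is one AB traversal
(`Curve.MakesCrossingIn.hasTraversals_one`), and conversely one AB traversal of a genuine shell
`r < R` contains a KS crossing (`Curve.HasTraversals.makesCrossing`: restrict to the sub-segment
between the last visit to the inner disc and the first subsequent exit from the open outer
disc), so the RSW-type inputs phrased with either notion can be transported.
-/

noncomputable section

open Set Metric

namespace Literature.Probability.RandomPlanarGeometry

namespace Curve

/-- A Kemppainen–Smirnov crossing of `A(z₀, r, R)` (inside any `S`) is one Aizenman–Burchard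
traversal of the shell `D(z₀; r, R)`. [cite: KemppainenSmirnov2017, Def. 1.1] -/
theorem MakesCrossingIn.hasTraversals_one {γ : Curve ℂ} {z₀ : ℂ} {r R : ℝ} {S : Set ℂ}
    (h : γ.MakesCrossingIn z₀ r R S) : γ.HasTraversals 1 z₀ r R := by
  obtain ⟨s, t, hst, hends, -⟩ := h
  exact ⟨fun _ ↦ s, fun _ ↦ t, fun _ ↦ ⟨hst.le, hends⟩, fun i j hij ↦
    absurd (Fin.lt_def.1 hij) (by omega)⟩

/-- A Kemppainen–Smirnov crossing of `A(z₀, r, R)` is one Aizenman–Burchard traversal.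
[cite: KemppainenSmirnov2017, Def. 1.1] -/
theorem MakesCrossing.hasTraversals_one {γ : Curve ℂ} {z₀ : ℂ} {r R : ℝ}
    (h : γ.MakesCrossing z₀ r R) : γ.HasTraversals 1 z₀ r R :=
  MakesCrossingIn.hasTraversals_one h

/-- **One traversal of a genuine shell contains a crossing.** If `γ` traverses `D(z₀; r, R)`
once and `r < R`, then `γ` makes a Kemppainen–Smirnov crossing of `A(z₀, r, R)`: between an
endpoint in the closed inner disc and an endpoint outside the open outer disc, the last time in
the inner disc and the first subsequent time outside the outer disc bound a sub-segment whose
interior lies in the open annulus. (Aizenman–Burchard 1999, §1.b, remark after (1.2): "any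
segment joining the two boundary components contains a sub-segment in the shell".)
[cite: AizenmanBurchardDuke1999, §1.b] -/
theorem HasTraversals.makesCrossing {γ : Curve ℂ} {z₀ : ℂ} {r R : ℝ} (hrR : r < R)
    (h : γ.HasTraversals 1 z₀ r R) : γ.MakesCrossing z₀ r R := by
  obtain ⟨s, t, hst, -⟩ := h
  obtain ⟨hle, hends⟩ := hst 0
  -- work with a traversal oriented from the inner disc to the outside (time-reversal symmetric
  -- statement: we treat the two orientations separately but identically)
  set f : unitInterval → ℝ := fun u ↦ dist (γ u) z₀ with hf
  have hfc : Continuous f := γ.continuous.dist continuous_const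
  rcases hends with ⟨hin, hout⟩ | ⟨hout, hin⟩
  · -- inner endpoint first: last time `a ∈ [s, t]` with `f a ≤ r`, then first time `b ∈ [a, t]` with `R ≤ f b`
    have hA : IsClosed {u : unitInterval | u ∈ Icc (s 0) (t 0) ∧ f u ≤ r} :=
      (isClosed_Icc.inter (isClosed_le hfc continuous_const))
    obtain ⟨a, ⟨⟨hsa, hat⟩, har⟩, hamax⟩ := hA.isCompact.exists_isGreatest ⟨s 0, ⟨le_rfl, hle⟩, hin⟩
    have hB : IsClosed {u : unitInterval | u ∈ Icc a (t 0) ∧ R ≤ f u} :=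
      (isClosed_Icc.inter (isClosed_le continuous_const hfc))
    obtain ⟨b, ⟨⟨hab, hbt⟩, hbR⟩, hbmin⟩ := hB.isCompact.exists_isLeast ⟨t 0, ⟨hat, le_rfl⟩, hout⟩
    refine ⟨a, b, ?_, Or.inl ⟨har, hbR⟩, fun u hau hub ↦ ⟨⟨?_, ?_⟩, mem_univ _⟩⟩
    · rcases hab.lt_or_eq with hlt | heq
      · exact hlt
      · exfalso
        rw [← heq] at hbR
        exact absurd (har.trans_lt hrR) (not_lt.2 hbR)
    · -- `r < f u`: otherwise `u` would be a later time in the inner disc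
      by_contra hle'
      have hu : f u ≤ r := not_lt.1 hle'
      have := hamax ⟨⟨hsa.trans hau.le, hub.le.trans hbt⟩, hu⟩
      exact absurd hau (not_lt.2 this)
    · -- `f u < R`: otherwise `u` would be an earlier exit time
      by_contra hge
      have hu : R ≤ f u := not_lt.1 hge
      have := hbmin ⟨⟨hau.le, hub.le.trans hbt⟩, hu⟩
      exact absurd hub (not_lt.2 this)
  · -- outer endpoint first: first time `b ∈ [s, t]` with `f b ≤ r`, then last time `a ∈ [s, b]` with `R ≤ f a`
    have hB : IsClosed {u : unitInterval | u ∈ Icc (s 0) (t 0) ∧ f u ≤ r} :=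
      (isClosed_Icc.inter (isClosed_le hfc continuous_const))
    obtain ⟨b, ⟨⟨hsb, hbt⟩, hbr⟩, hbmin⟩ := hB.isCompact.exists_isLeast ⟨t 0, ⟨hle, le_rfl⟩, hin⟩
    have hA : IsClosed {u : unitInterval | u ∈ Icc (s 0) b ∧ R ≤ f u} :=
      (isClosed_Icc.inter (isClosed_le continuous_const hfc))
    obtain ⟨a, ⟨⟨hsa, hab⟩, haR⟩, hamax⟩ := hA.isCompact.exists_isGreatest ⟨s 0, ⟨le_rfl, hsb⟩, hout⟩
    refine ⟨a, b, ?_, Or.inr ⟨haR, hbr⟩, fun u hau hub ↦ ⟨⟨?_, ?_⟩, mem_univ _⟩⟩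
    · rcases hab.lt_or_eq with hlt | heq
      · exact hlt
      · exfalso
        rw [heq] at haR
        exact absurd (hbr.trans_lt hrR) (not_lt.2 haR)
    · by_contra hle'
      have hu : f u ≤ r := not_lt.1 hle'
      have := hbmin ⟨⟨hsa.trans hau.le, hub.le.trans hbt⟩, hu⟩
      exact absurd hub (not_lt.2 this)
    · by_contra hge
      have hu : R ≤ f u := not_lt.1 hge
      have := hamax ⟨⟨hsa.trans hau.le, hub.le⟩, hu⟩
      exact absurd hau (not_lt.2 this)

end Curve

end Literature.Probability.RandomPlanarGeometry
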